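import Mathlib.Geometry.Manifold.BumpFunction
import Mathlib.Geometry.Manifold.Algebra.Structures
import Literature.Analysis.FunctionSpaces.PeriodicPrimitive
import HarnessLib

/-!
# Smooth dependence of interval integrals on a manifold parameter; smooth parametric primitives

Geometry/Manifold support file: the manifold-parameter versions of the tree's
`Literature.Analysis.FunctionSpaces.contDiff_parametric_intervalIntegral` /
`contDiff_parametric_primitive` (there the parameter ranges over a finite-dimensional normed space).
Differentiation under the integral sign is local in the parameter, so for a boundaryless `C^∞`
manifold `P` (finite-dimensional model) one localises with a smooth bump function supported in a
chart (Hörmander, *The Analysis of Linear Partial Differential Operators I*, Thm. 1.1.7 ff.;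
Lee, *Introduction to Smooth Manifolds*, 2nd ed., Lemma 2.26 (extension by bump functions)):

* `Literature.Geometry.Manifold.contMDiff_parametric_intervalIntegral` — `Φ : P × ℝ → ℝ` of class
  `C^∞` ⟹ `p ↦ ∫ σ in a..b, Φ (p, σ)` is `C^∞` on `P`;
* `Literature.Geometry.Manifold.contMDiff_parametric_primitive` — `φ : P × ℝ → ℝ` of class `C^∞`
  ⟹ `(p, t) ↦ ∫₀ᵗ φ (p, τ) dτ` is `C^∞` on `P × ℝ` (substitution `τ = tσ`).

Used by `Literature/Topology/Immersions/GromovFoldedFunctionLemma.lean` (Gromov, *Partial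
Differential Relations*, §2.1.3 (A′): `f(v,t) = f₀(v,0) + ∫₀ᵗ φ(v,τ) dτ` on `V₀ × [0,1]`).
Everything is proved; no definitions, no named facts.

## Mathlib search

Mathlib (this pin) has smooth bump functions on manifolds (`SmoothBumpFunction`, with
`contMDiff_smul`) and one derivative under the integral sign
(`intervalIntegral.hasFDerivAt_integral_of_dominated_of_fderiv_le`), but no `ContMDiff` statement
for parametric integrals (searched `contMDiff`/`ContMDiff` + `integral`/`∫` in `Geometry/Manifold`,
`MeasureTheory/Integral`: none).

## References

* L. Hörmander, *The Analysis of Linear Partial Differential Operators I*, 2nd ed. (1990),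
  Thm. 1.1.7–1.1.9. [folklore]
* J. M. Lee, *Introduction to Smooth Manifolds*, 2nd ed. (2013), Lemma 2.26. [folklore]
-/

noncomputable section

open Set Function Filter MeasureTheory Metric intervalIntegral
open scoped Manifold ContDiff Topology

namespace Literature.Geometry.Manifold

section ParametricIntegral

variable {E : Type*} [NormedAddCommGroup E] [NormedSpace ℝ E] [FiniteDimensional ℝ E]
  {H : Type*} [TopologicalSpace H] {J : ModelWithCorners ℝ E H} [J.Boundaryless]
  {P : Type*} [TopologicalSpace P] [ChartedSpace H P] [IsManifold J ∞ P]

/-- **Differentiation under the integral sign, manifold parameter.**  If `Φ : P × ℝ → ℝ` is `C^∞`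
(`P` a boundaryless `C^∞` manifold over a finite-dimensional model) then
`p ↦ ∫ σ in a..b, Φ (p, σ)` is `C^∞` on `P`.  Proof: localise at `p₀` with a smooth bump function
`ρ` (equal to `1` near `p₀`, supported in the chart at `p₀`); in the chart the integrand
`(σ, x) ↦ ρ̂(x) Φ(e⁻¹ x, σ)` is `C^∞` on `ℝ × E`, so the tree's
`Literature.Analysis.FunctionSpaces.contDiff_parametric_intervalIntegral` applies, and the two integrals agree where `ρ = 1`.
[folklore] -/
theorem contMDiff_parametric_intervalIntegral {Φ : P × ℝ → ℝ}
    (hΦ : ContMDiff (J.prod 𝓘(ℝ, ℝ)) 𝓘(ℝ, ℝ) ∞ Φ) (a b : ℝ) :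
    ContMDiff J 𝓘(ℝ, ℝ) ∞ fun p : P => ∫ σ in a..b, Φ (p, σ) := by
  intro p₀
  obtain ⟨ρ⟩ : Nonempty (SmoothBumpFunction J p₀) := inferInstance
  set e := extChartAt J p₀ with he
  -- the integrand read in the chart, cut off by the bump
  obtain ⟨Ψ, hΨ_def⟩ : ∃ Ψ : E × ℝ → ℝ, Ψ = fun q => Φ (e.symm q.1, q.2) := ⟨_, rfl⟩
  have hsymm : ContMDiffOn 𝓘(ℝ, E) J ∞ e.symm e.target := contMDiffOn_extChartAt_symm p₀
  have hΨm : ContMDiffOn (𝓘(ℝ, E).prod 𝓘(ℝ, ℝ)) 𝓘(ℝ, ℝ) ∞ Ψ (e.target ×ˢ (univ : Set ℝ)) := by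
    rw [hΨ_def]
    exact hΦ.comp_contMDiffOn (hsymm.prodMap contMDiffOn_id)
  have hΨ : ContDiffOn ℝ ∞ Ψ (e.target ×ˢ (univ : Set ℝ)) := by
    rw [← contMDiffOn_iff_contDiffOn, modelWithCornersSelf_prod, ← chartedSpaceSelf_prod]
    exact hΨm
  have htarget : IsOpen e.target := isOpen_extChartAt_target p₀
  set β : ContDiffBump (e p₀) := ρ.toContDiffBump with hβ
  obtain ⟨G, hG_def⟩ : ∃ G : ℝ × E → ℝ, G = fun q => β q.2 * Ψ (q.2, q.1) := ⟨_, rfl⟩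
  have hball : closedBall (e p₀) β.rOut ⊆ e.target := by
    have h := ρ.closedBall_subset
    rw [ModelWithCorners.Boundaryless.range_eq_univ, inter_univ] at h
    exact h
  have hG : ContDiff ℝ ∞ G := by
    refine contDiff_iff_contDiffAt.2 fun q => ?_
    by_cases hq : q.2 ∈ e.target
    · have h1 : ContDiffAt ℝ ∞ (fun q : ℝ × E => β q.2) q := β.contDiff.contDiffAt.comp q contDiffAt_snd
      have h2 : ContDiffAt ℝ ∞ (fun q : ℝ × E => Ψ (q.2, q.1)) q := by
        have hmem : (q.2, q.1) ∈ e.target ×ˢ (univ : Set ℝ) := ⟨hq, mem_univ _⟩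
        have h3 : ContDiffAt ℝ ∞ Ψ (q.2, q.1) :=
          hΨ.contDiffAt ((htarget.prod isOpen_univ).mem_nhds hmem)
        have hswap : ContDiffAt ℝ ∞ (fun q : ℝ × E => ((q.2, q.1) : E × ℝ)) q :=
          contDiffAt_snd.prodMk contDiffAt_fst
        exact h3.comp q hswap
      rw [hG_def]
      exact h1.mul h2
    · -- outside the target the bump vanishes identically near `q`
      have hq' : q.2 ∉ tsupport β := by
        rw [β.tsupport_eq]
        exact fun h => hq (hball h)
      have hzero : (fun q : ℝ × E => β q.2) =ᶠ[𝓝 q] fun _ => 0 := by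
        have hopen : IsOpen ((tsupport β)ᶜ) := (isClosed_tsupport _).isOpen_compl
        have hev : ∀ᶠ q' in 𝓝 q, q'.2 ∈ (tsupport β)ᶜ :=
          (continuous_snd.isOpen_preimage _ hopen).mem_nhds hq'
        filter_upwards [hev] with q' hq'
        exact image_eq_zero_of_notMem_tsupport hq'
      have hGz : G =ᶠ[𝓝 q] fun _ => 0 := by
        filter_upwards [hzero] with q' hq'
        simp only [hG_def, hq', zero_mul]
      exact (contDiffAt_const (c := (0 : ℝ))).congr_of_eventuallyEq hGz
  -- the integral in the chart is `C^∞` on `E`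
  have hI : ContDiff ℝ ∞ fun x : E => ∫ σ in a..b, G (σ, x) :=
    Literature.Analysis.FunctionSpaces.contDiff_parametric_intervalIntegral hG a b
  -- compose with the chart
  have hcomp : ContMDiffAt J 𝓘(ℝ, ℝ) ∞ (fun p : P => ∫ σ in a..b, G (σ, e p)) p₀ :=
    hI.contDiffAt.contMDiffAt.comp p₀ (contMDiffAt_extChartAt (I := J) (x := p₀))
  -- the two integrands agree where `ρ = 1` inside the chart source
  have hsrc : ∀ᶠ p in 𝓝 p₀, p ∈ (chartAt H p₀).source :=
    (chartAt H p₀).open_source.mem_nhds (mem_chart_source H p₀)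
  have hone : ∀ᶠ p in 𝓝 p₀, ρ p = 1 := ρ.eventuallyEq_one
  refine hcomp.congr_of_eventuallyEq ?_
  filter_upwards [hsrc, hone] with p hp hp1
  have hsymm_apply : e.symm (e p) = p := e.left_inv (by rwa [he, extChartAt_source])
  have hβp : β (e p) = ρ p := (ρ.eqOn_source hp).symm
  refine intervalIntegral.integral_congr fun σ _ => ?_
  simp only [hG_def, hΨ_def, hsymm_apply, hβp, hp1, one_mul]

/-- **Smooth parametric primitives on a manifold**: if `φ : V × ℝ → ℝ` is `C^∞` then so is
`(v, t) ↦ ∫₀ᵗ φ (v, τ) dτ` on `V × ℝ` (substitute `τ = tσ`: `∫₀ᵗ φ(v,τ) dτ = ∫₀¹ t φ(v,tσ) dσ`,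
an integral over the fixed interval `[0,1]` with parameter `(v,t)`). [folklore] -/
theorem contMDiff_parametric_primitive {φ : P × ℝ → ℝ}
    (hφ : ContMDiff (J.prod 𝓘(ℝ, ℝ)) 𝓘(ℝ, ℝ) ∞ φ) :
    ContMDiff (J.prod 𝓘(ℝ, ℝ)) 𝓘(ℝ, ℝ) ∞ fun p : P × ℝ => ∫ τ in (0 : ℝ)..p.2, φ (p.1, τ) := by
  have hsub : (fun p : P × ℝ => ∫ τ in (0 : ℝ)..p.2, φ (p.1, τ)) =
      fun p : P × ℝ => ∫ σ in (0 : ℝ)..1, p.2 * φ (p.1, p.2 * σ) := by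
    funext p
    exact Literature.Analysis.FunctionSpaces.integral_eq_integral_unit_smul (fun τ => φ (p.1, τ)) p.2
  rw [hsub]
  -- the integrand `((v,t), σ) ↦ t φ(v, tσ)` is `C^∞` on `(P × ℝ) × ℝ`
  have h1 : ContMDiff ((J.prod 𝓘(ℝ, ℝ)).prod 𝓘(ℝ, ℝ)) (J.prod 𝓘(ℝ, ℝ)) ∞
      fun q : (P × ℝ) × ℝ => (q.1.1, q.1.2 * q.2) := by
    refine (contMDiff_fst.comp contMDiff_fst).prodMk ?_
    exact (contMDiff_snd.comp contMDiff_fst).mul contMDiff_snd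
  have h2 : ContMDiff ((J.prod 𝓘(ℝ, ℝ)).prod 𝓘(ℝ, ℝ)) 𝓘(ℝ, ℝ) ∞
      fun q : (P × ℝ) × ℝ => q.1.2 * φ (q.1.1, q.1.2 * q.2) :=
    (contMDiff_snd.comp contMDiff_fst).mul (hφ.comp h1)
  exact contMDiff_parametric_intervalIntegral (J := J.prod 𝓘(ℝ, ℝ)) h2 0 1

end ParametricIntegral

end Literature.Geometry.Manifold
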